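import Summits.ResolutionOfSingularities.ResolutionOfSingularities.Theorems.PurelyInseparableDim4PhiLinePolygon
import Summits.ResolutionOfSingularities.ResolutionOfSingularities.Theorems.PurelyInseparableDim4ChartDictionary
import Summits.ResolutionOfSingularities.ResolutionOfSingularities.Theorems.PurelyInseparableDim4FlatAbsorbComm
import HarnessLib

/-!
# (K-Φ2) chain dictionary I: the LOCAL CHART HOMOMORPHISM of a point blow-up step and the weak transform of a principal ideal

Cell `res-dim4-pi` (D-0157 DOOR 2), Φ = β_h line of res-dim4-idea-1 (CARD I-1-8; «the one shape §7 wants beyond (K-Φ3): the TRANSPORT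
identity (K-Φ2)», idea-1 g6 04:06:11Z; critic B crit-2 g3 V-B-62: «the carried label is ALWAYS LINEAR; (K-Φ2) = linear strict-transform
bookkeeping + centre ⊂ E_h»). The polygon laws of the tree (`WeightedOrder.betaS_colon_u2_lt`, `betaS_colon_le`,
`PointBlowupPolygonLaws(U2)Indexed`) are stated for an ABSTRACT chart: a ring map `φ : R → R′`, frames `c, c′` with
`c′ pivot = φ (c pivot)`, `φ (c i) = φ (c pivot) · c′ i`, and the weak transform `(J R′ : φ(pivot)^μ)`. This file instantiates that
shape for the tree's STEP at the point `b` of the `x_j`-chart of the blow-up of the origin of `𝔸⁴` (`CentreBlowup.step p univ j b`), with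
`R = R′ = 𝒪 = K[x]_{𝔪₀} = OriginLocalization K 4` and LINEAR frames, DEF-FREE over the tree's `coordBlowupSubst` (Hu 2025 Prop. 5.3),
`PointBlowup.translate`, `CentreBlowup.chartTransform`, `Localization.localRingHom`:

* §1 the translated chart substitution `θ = PointBlowup.translate b ∘ coordBlowupSubst K univ j` (`x_i ↦ (x_i + b_i) x_j`, `x_j ↦ x_j`, `b_j = 0`):
  values on variables, `constantCoeff_translate_coordBlowupSubst` (`θ f (0) = f(0)`), `comap_translate_coordBlowupSubst_originIdeal`
  (`θ⁻¹ 𝔪₀ = 𝔪₀`), and on LINEAR FORMS `translate_coordBlowupSubst_linearForm`: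
  `θ(Σ ℓ_t x_t) = x_j · (Σ_{t≠j} ℓ_t x_t + ℓ(b + e_j))` — the strict transform of a linear form through the centre is LINEAR
  again exactly when the new point lies on it (`ℓ(b + e_j) = 0`, nearness);
* §2 the local chart homomorphism `φ = Localization.localRingHom 𝔪₀ 𝔪₀ θ _ : 𝒪 →+* 𝒪` and its values on `algebraMap` of
  polynomials (`localRingHom_chart_algebraMap`); the pivot relations of the abstract chart for linear frames
  (`localRingHom_chart_X_self`, `localRingHom_chart_X_of_eq_zero`, `localRingHom_chart_linearForm`);
* §3 the weak transform of a principal ideal: `colon_span_singleton_mul_eq` (in a domain `((a h) : a) = (h)`),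
  `translate_coordBlowupSubst_eq_X_pow_mul` (`θ G = x_j^d · H₀`, `H₀ = PointBlowup.translate b (chartTransform d univ j G)`, `d ≤ ord₀ G`, via typ-2's
  `ChartDictionary.coordBlowupSubst_eq_X_pow_mul_chartTransform`), and **`colon_map_span_singleton_chart`**:
  `((G)·𝒪 under φ : x_j^d) = (H₀)·𝒪` — the `J (k+1)`-slot of `PhiLine.keepCount_add_betaS_le_of_betaS_le` for the weak transform.

The residual of the tree's next STATE (`(step p univ j b s).F = x^{r′}·G′`, `G′ = ε H₀ + R̃`, cleaning) versus `H₀` is the next file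
(K-Φ2) II; its `β` agrees by `PhiLine.betaS_eq_of_cleaning` (FILE V). [OURS · counted 0 · AI work weaker than expert review.] Nothing here
proves K2(p), the β_h line, or resolution of singularities in dimension ≥ 4 / characteristic p.

Sources: V. Cossart, U. Jannsen, S. Saito, LNM **2270** (2020), Lemma 12.1/12.2 (the `u₁`/`u₂`-charts), (9.6)–(9.7) [`CossartJannsenSaito2020`];
Y. Hu (2025) Prop. 5.3 / Görtz–Wedhorn (13.19) (the chart substitution) [`Hu2025`]; H. Hauser, BAMS 47 (2010) §§F–G [`Hauser2010`].
-/

set_option linter.dupNamespace false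

noncomputable section

namespace Summit.ResolutionOfSingularities.ResolutionOfSingularities.Theorems.PIDim4

namespace PhiLine

open MvPolynomial Finset IsLocalRing
open Literature.AlgebraicGeometry.Resolution
open Literature.AlgebraicGeometry.Resolution.Hauser2010 (ordZero)

variable {K : Type} [Field K]

/-! ## §1 The translated chart substitution `θ = PointBlowup.translate b ∘ coordBlowupSubst K univ j` -/

/-- `PointBlowup.translate b` is multiplicative (it is an algebra map). [folklore] -/
theorem translate_mul_eq (b : Fin 4 → K) (F G : MvPolynomial (Fin 4) K) : PointBlowup.translate b (F * G) = PointBlowup.translate b F * PointBlowup.translate b G := by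
  unfold PointBlowup.translate; rw [map_mul]

/-- `PointBlowup.translate b (F ^ n) = (PointBlowup.translate b F) ^ n`. [folklore] -/
theorem translate_pow_eq (b : Fin 4 → K) (F : MvPolynomial (Fin 4) K) (n : ℕ) : PointBlowup.translate b (F ^ n) = PointBlowup.translate b F ^ n := by
  unfold PointBlowup.translate; rw [map_pow]

/-- `θ(x_j) = x_j` when `b_j = 0` (the exceptional variable). [cite: Hu2025, Prop. 5.3] -/
theorem translate_coordBlowupSubst_X_self {j : Fin 4} {b : Fin 4 → K} (hbj : b j = 0) :
    PointBlowup.translate b (coordBlowupSubst K (↑(Finset.univ : Finset (Fin 4))) j (X j)) = X j := by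
  rw [coordBlowupSubst_X_self, FlatAbsorb.translate_X, hbj, C_0, add_zero]

/-- `θ(x_i) = (x_i + b_i) · x_j` for `i ≠ j` when `b_j = 0`. [cite: Hu2025, Prop. 5.3] -/
theorem translate_coordBlowupSubst_X_of_ne {j i : Fin 4} (hij : i ≠ j) {b : Fin 4 → K} (hbj : b j = 0) :
    PointBlowup.translate b (coordBlowupSubst K (↑(Finset.univ : Finset (Fin 4))) j (X i)) = (X i + C (b i)) * X j := by
  rw [coordBlowupSubst_X_of_mem_of_ne K _ _ (by simp) hij, translate_mul_eq, FlatAbsorb.translate_X, FlatAbsorb.translate_X, hbj, C_0, add_zero,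
    mul_comm]

/-- `θ(x_i) = x_i · x_j` for `i ≠ j` with `b_i = 0` (a boundary letter through the new point). [cite: Hu2025, Prop. 5.3] -/
theorem translate_coordBlowupSubst_X_of_eq_zero {j i : Fin 4} (hij : i ≠ j) {b : Fin 4 → K} (hbj : b j = 0) (hbi : b i = 0) :
    PointBlowup.translate b (coordBlowupSubst K (↑(Finset.univ : Finset (Fin 4))) j (X i)) = X i * X j := by
  rw [translate_coordBlowupSubst_X_of_ne hij hbj, hbi, C_0, add_zero]

/-- **`θ` preserves the value at the origin**: `(θ f)(0) = f(0)` (every `θ(x_i)` vanishes at `0`). [cite: Hu2025, Prop. 5.3] -/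
theorem constantCoeff_translate_coordBlowupSubst {j : Fin 4} {b : Fin 4 → K} (hbj : b j = 0) (F : MvPolynomial (Fin 4) K) :
    constantCoeff (PointBlowup.translate b (coordBlowupSubst K (↑(Finset.univ : Finset (Fin 4))) j F)) = constantCoeff F := by
  induction F using MvPolynomial.induction_on with
  | C a => rw [coordBlowupSubst_C, FlatAbsorb.translate_C]
  | add p q hp hq => rw [map_add]; unfold PointBlowup.translate at *; rw [map_add, map_add, hp, hq, map_add]
  | mul_X p i hp =>
    rw [map_mul, translate_mul_eq, map_mul, hp, map_mul, constantCoeff_X, mul_zero]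
    by_cases hij : i = j
    · subst hij; rw [translate_coordBlowupSubst_X_self hbj, constantCoeff_X, mul_zero]
    · rw [translate_coordBlowupSubst_X_of_ne hij hbj, map_mul, constantCoeff_X, mul_zero, mul_zero]

/-- **`θ⁻¹(𝔪₀) = 𝔪₀`**: the chart map sends the new origin to the old one. [cite: Hu2025, Prop. 5.3] -/
theorem comap_translate_coordBlowupSubst_originIdeal {j : Fin 4} {b : Fin 4 → K} (hbj : b j = 0) :
    Literature.AlgebraicGeometry.Resolution.originIdeal K 4 =
      (Literature.AlgebraicGeometry.Resolution.originIdeal K 4).comap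
        (((aeval fun i => (X i + C (b i) : MvPolynomial (Fin 4) K)).comp
          (coordBlowupSubst K (↑(Finset.univ : Finset (Fin 4))) j)).toRingHom) := by
  ext F
  rw [Ideal.mem_comap, Literature.AlgebraicGeometry.Resolution.mem_originIdeal_iff,
    Literature.AlgebraicGeometry.Resolution.mem_originIdeal_iff]
  change _ ↔ constantCoeff (PointBlowup.translate b (coordBlowupSubst K _ j F)) = 0
  rw [constantCoeff_translate_coordBlowupSubst hbj]

/-- **Strict transform of a LINEAR FORM**: `θ(Σ_t ℓ_t x_t) = x_j · (Σ_{t} ℓ′_t x_t + ℓ(b + e_j))` with `ℓ′ = ℓ` off `j`, `ℓ′_j = 0` —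
linear again (drop the chart letter) exactly when the new point `(b : 1)` lies on `ℓ = 0`. [cite: CossartJannsenSaito2020, Lemma 12.2] -/
theorem translate_coordBlowupSubst_linearForm {j : Fin 4} {b : Fin 4 → K} (hbj : b j = 0) (ℓ : Fin 4 → K) :
    PointBlowup.translate b (coordBlowupSubst K (↑(Finset.univ : Finset (Fin 4))) j (∑ t, C (ℓ t) * X t)) =
      X j * (∑ t, C (Function.update ℓ j 0 t) * X t + C (∑ t, ℓ t * Function.update b j 1 t)) := by
  rw [map_sum]
  unfold PointBlowup.translate
  rw [map_sum]
  have hterm : ∀ t : Fin 4, aeval (fun i => (X i + C (b i) : MvPolynomial (Fin 4) K))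
      (coordBlowupSubst K (↑(Finset.univ : Finset (Fin 4))) j (C (ℓ t) * X t)) =
      X j * (C (Function.update ℓ j 0 t) * X t + C (ℓ t * Function.update b j 1 t)) := by
    intro t
    rw [map_mul, coordBlowupSubst_C, map_mul, aeval_C, algebraMap_eq]
    by_cases htj : t = j
    · subst htj
      change C (ℓ t) * PointBlowup.translate b (coordBlowupSubst K _ t (X t)) = _
      rw [translate_coordBlowupSubst_X_self hbj, Function.update_self, Function.update_self, C_0, zero_mul, zero_add, mul_one]
      ring
    · change C (ℓ t) * PointBlowup.translate b (coordBlowupSubst K _ j (X t)) = _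
      rw [translate_coordBlowupSubst_X_of_ne htj hbj, Function.update_of_ne htj, Function.update_of_ne htj, map_mul]
      ring
  rw [Finset.sum_congr rfl fun t _ => hterm t, ← Finset.mul_sum, Finset.sum_add_distrib, map_sum]

/-! ## §2 The local chart homomorphism `φ : 𝒪 → 𝒪` and the pivot relations for linear frames -/

/-- `φ (f/1) = θ(f)/1`: the local chart homomorphism on (images of) polynomials. [cite: CossartJannsenSaito2020, (9.6)] -/
theorem localRingHom_chart_algebraMap {j : Fin 4} {b : Fin 4 → K} (hbj : b j = 0) (F : MvPolynomial (Fin 4) K) :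
    Localization.localRingHom (Literature.AlgebraicGeometry.Resolution.originIdeal K 4)
        (Literature.AlgebraicGeometry.Resolution.originIdeal K 4)
        (((aeval fun i => (X i + C (b i) : MvPolynomial (Fin 4) K)).comp
          (coordBlowupSubst K (↑(Finset.univ : Finset (Fin 4))) j)).toRingHom)
        (comap_translate_coordBlowupSubst_originIdeal hbj)
        (algebraMap (MvPolynomial (Fin 4) K) (OriginLocalization K 4) F) =
      algebraMap (MvPolynomial (Fin 4) K) (OriginLocalization K 4)
        (PointBlowup.translate b (coordBlowupSubst K (↑(Finset.univ : Finset (Fin 4))) j F)) := by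
  rw [Localization.localRingHom_to_map]
  rfl

/-- **Pivot**: `φ (x_j/1) = x_j/1` (`c′ pivot = φ (c pivot)` with the chart letter as pivot). [cite: CossartJannsenSaito2020, Lemma 12.2] -/
theorem localRingHom_chart_X_self {j : Fin 4} {b : Fin 4 → K} (hbj : b j = 0) :
    Localization.localRingHom (Literature.AlgebraicGeometry.Resolution.originIdeal K 4)
        (Literature.AlgebraicGeometry.Resolution.originIdeal K 4)
        (((aeval fun i => (X i + C (b i) : MvPolynomial (Fin 4) K)).comp
          (coordBlowupSubst K (↑(Finset.univ : Finset (Fin 4))) j)).toRingHom)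
        (comap_translate_coordBlowupSubst_originIdeal hbj)
        (algebraMap (MvPolynomial (Fin 4) K) (OriginLocalization K 4) (X j)) =
      algebraMap (MvPolynomial (Fin 4) K) (OriginLocalization K 4) (X j) := by
  rw [localRingHom_chart_algebraMap hbj, translate_coordBlowupSubst_X_self hbj]

/-- **Kept boundary letter**: `φ (x_i/1) = (x_j/1) · (x_i/1)` for `i ≠ j` with `b_i = 0`. [cite: CossartJannsenSaito2020, Lemma 12.2] -/
theorem localRingHom_chart_X_of_eq_zero {j i : Fin 4} (hij : i ≠ j) {b : Fin 4 → K} (hbj : b j = 0) (hbi : b i = 0) :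
    Localization.localRingHom (Literature.AlgebraicGeometry.Resolution.originIdeal K 4)
        (Literature.AlgebraicGeometry.Resolution.originIdeal K 4)
        (((aeval fun i => (X i + C (b i) : MvPolynomial (Fin 4) K)).comp
          (coordBlowupSubst K (↑(Finset.univ : Finset (Fin 4))) j)).toRingHom)
        (comap_translate_coordBlowupSubst_originIdeal hbj)
        (algebraMap (MvPolynomial (Fin 4) K) (OriginLocalization K 4) (X i)) =
      algebraMap (MvPolynomial (Fin 4) K) (OriginLocalization K 4) (X j) *
        algebraMap (MvPolynomial (Fin 4) K) (OriginLocalization K 4) (X i) := by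
  rw [localRingHom_chart_algebraMap hbj, translate_coordBlowupSubst_X_of_eq_zero hij hbj hbi, map_mul, mul_comm]

/-- **Carried linear letter**: for a linear form through the new point (`ℓ(b + e_j) = 0`),
`φ (ℓ/1) = (x_j/1) · (ℓ′/1)` with `ℓ′ = Σ_{t ≠ j} ℓ_t x_t` linear. [cite: CossartJannsenSaito2020, Lemma 12.2] -/
theorem localRingHom_chart_linearForm {j : Fin 4} {b : Fin 4 → K} (hbj : b j = 0) (ℓ : Fin 4 → K)
    (hnear : ∑ t, ℓ t * Function.update b j 1 t = 0) :
    Localization.localRingHom (Literature.AlgebraicGeometry.Resolution.originIdeal K 4)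
        (Literature.AlgebraicGeometry.Resolution.originIdeal K 4)
        (((aeval fun i => (X i + C (b i) : MvPolynomial (Fin 4) K)).comp
          (coordBlowupSubst K (↑(Finset.univ : Finset (Fin 4))) j)).toRingHom)
        (comap_translate_coordBlowupSubst_originIdeal hbj)
        (algebraMap (MvPolynomial (Fin 4) K) (OriginLocalization K 4) (∑ t, C (ℓ t) * X t)) =
      algebraMap (MvPolynomial (Fin 4) K) (OriginLocalization K 4) (X j) *
        algebraMap (MvPolynomial (Fin 4) K) (OriginLocalization K 4) (∑ t, C (Function.update ℓ j 0 t) * X t) := by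
  rw [localRingHom_chart_algebraMap hbj, translate_coordBlowupSubst_linearForm hbj, hnear, C_0, add_zero, map_mul]

/-! ## §3 The weak transform of a principal ideal -/

/-- In a domain, `((a·h) : a) = (h)` for `a ≠ 0`. [folklore] -/
theorem colon_span_singleton_mul_eq {A : Type*} [CommRing A] [IsDomain A] {a : A} (ha : a ≠ 0) (h : A) :
    (Ideal.span {a * h}).colon {a} = Ideal.span {h} := by
  ext x
  rw [Submodule.mem_colon, Ideal.mem_span_singleton]
  constructor
  · intro hx
    have hx' := hx a (Set.mem_singleton a)
    rw [smul_eq_mul, Ideal.mem_span_singleton] at hx'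
    obtain ⟨y, hy⟩ := hx'
    refine ⟨y, mul_left_cancel₀ ha ?_⟩
    rw [mul_comm a x, hy]; ring
  · rintro ⟨y, rfl⟩ s hs
    rw [Set.mem_singleton_iff.mp hs, smul_eq_mul, Ideal.mem_span_singleton]
    exact ⟨y, by ring⟩

/-- `θ G = x_j^d · H₀` with `H₀ = PointBlowup.translate b (chartTransform d univ j G)` when `d ≤ ord₀ G` (no truncation: typ-2's
`ChartDictionary.coordBlowupSubst_eq_X_pow_mul_chartTransform`, then translate with `b_j = 0`). [cite: Hauser2010, §F] -/
theorem translate_coordBlowupSubst_eq_X_pow_mul {j : Fin 4} {b : Fin 4 → K} (hbj : b j = 0) {d : ℕ} (G : MvPolynomial (Fin 4) K)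
    (hd : (d : ℕ∞) ≤ ordZero G) :
    PointBlowup.translate b (coordBlowupSubst K (↑(Finset.univ : Finset (Fin 4))) j G) =
      X j ^ d * PointBlowup.translate b (CentreBlowup.chartTransform d Finset.univ j G) := by
  rw [ChartDictionary.coordBlowupSubst_eq_X_pow_mul_chartTransform (Finset.mem_univ j) d G
      (by rwa [CentreBlowup.ordAlong_univ]), translate_mul_eq, translate_pow_eq, FlatAbsorb.translate_X, hbj, C_0, add_zero]

/-- `x_j/1 ≠ 0` in `𝒪` (and so are its powers): `K[x] → 𝒪` is injective. [folklore] -/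
theorem algebraMap_X_pow_ne_zero (j : Fin 4) (d : ℕ) :
    (algebraMap (MvPolynomial (Fin 4) K) (OriginLocalization K 4) (X j)) ^ d ≠ 0 := by
  refine pow_ne_zero d ?_
  have hinj : Function.Injective (algebraMap (MvPolynomial (Fin 4) K) (OriginLocalization K 4)) :=
    IsLocalization.injective (M := (Literature.AlgebraicGeometry.Resolution.originIdeal K 4).primeCompl) (OriginLocalization K 4)
      (Ideal.primeCompl_le_nonZeroDivisors _)
  exact (map_ne_zero_iff _ hinj).mpr (X_ne_zero j)

/-- **The weak transform of a principal ideal under the chart step**: for `G ∈ K[x]` with `d ≤ ord₀ G`,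
`((G·𝒪)^φ : (x_j/1)^d) = H₀·𝒪`, `H₀ = PointBlowup.translate b (chartTransform d univ j G)` — the tree's «total transform divided by `x_j^d`,
re-centred at `b`», as the `J′` of the abstract polygon laws. [cite: CossartJannsenSaito2020, Lemma 12.1 (3)] [cite: Hauser2010, §F] -/
theorem colon_map_span_singleton_chart {j : Fin 4} {b : Fin 4 → K} (hbj : b j = 0) {d : ℕ} (G : MvPolynomial (Fin 4) K)
    (hd : (d : ℕ∞) ≤ ordZero G) :
    ((Ideal.span {algebraMap (MvPolynomial (Fin 4) K) (OriginLocalization K 4) G}).map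
        (Localization.localRingHom (Literature.AlgebraicGeometry.Resolution.originIdeal K 4)
          (Literature.AlgebraicGeometry.Resolution.originIdeal K 4)
          (((aeval fun i => (X i + C (b i) : MvPolynomial (Fin 4) K)).comp
            (coordBlowupSubst K (↑(Finset.univ : Finset (Fin 4))) j)).toRingHom)
          (comap_translate_coordBlowupSubst_originIdeal hbj))).colon
        {(algebraMap (MvPolynomial (Fin 4) K) (OriginLocalization K 4) (X j)) ^ d} =
      Ideal.span {algebraMap (MvPolynomial (Fin 4) K) (OriginLocalization K 4)
        (PointBlowup.translate b (CentreBlowup.chartTransform d Finset.univ j G))} := by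
  rw [Ideal.map_span, Set.image_singleton, localRingHom_chart_algebraMap hbj, translate_coordBlowupSubst_eq_X_pow_mul hbj G hd,
    map_mul, map_pow]
  exact colon_span_singleton_mul_eq (algebraMap_X_pow_ne_zero j d) _

end PhiLine

end Summit.ResolutionOfSingularities.ResolutionOfSingularities.Theorems.PIDim4

end
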